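import Literature.Topology.PlanarFoliations.ProngStar
import HarnessLib

/-!
# Leaf ends at a prong star are prong ends

Topic: Topology / PlanarFoliations, sequel to `ProngStar.lean`. Let `P` be an `n`-prong star at
the puncture `v` of the planar foliation `F` of `X ↪ ℂ` (bi-oriented, so that open leaves are
ordered and have forward/backward half-leaves and ω/α-limit sets). We prove the dynamical
description of a saddle: **a leaf end converging to `v` is, eventually, one of the `n` prongs**
(Camacho–Lins Neto, Ch. VII §2: "`∂Vᵢ` is either a closed orbit or a graph of `Y`", i.e. made of
separatrices of saddles; Tamura, §25, Lemma 6.6, the curves of types (b), (c)).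

* `ProngStar.horiz` (**definition**): the horizontal path of a sector at a height, with values
  in `X`; `ProngStar.continuousOn_horiz`, `ProngStar.horiz_mem_leaf`,
  `ProngStar.continuousOn_toLeafSpace_horiz` (**proved**): it is a leafwise continuous path.
* `ProngStar.H_eq_zero_of_fwd` (**proved**): once a forward half-leaf stays close to `v`, its
  points in the star have height `0` (the two ends of the horizontal through a point at a
  nonzero height — in its sector and across the axis in the neighbouring sector — are far from
  `v`, and one of them is ahead in the leaf order: an order-convexity argument).
* `ProngStar.exists_fwd_eq_prong` (**proved**, the main statement): if the leaf of `x` lies in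
  a compact set and its ω-limit set is contained in `{v}`, then some forward half-leaf is
  *exactly* an initial arc `{(β, 0) | 0 < β ≤ β₀}` of the prong of one sector.
* `ProngStar.flip` (**definition**) and `ProngStar.exists_bwd_eq_prong` (**proved**): the same
  for backward half-leaves and α-limit sets.

## References

* C. Camacho, A. Lins Neto, *Geometric Theory of Foliations*, Birkhäuser (1985), Ch. VII §2
  [CamachoLinsNeto1985].
* I. Tamura, *Topology of Foliations: An Introduction*, AMS (1992), §25 Lemma 6.6 [Tamura1992].
-/

noncomputable section

open Set Filter Function Metric
open _root_.Topology
open Literature.Topology.FourManifolds Literature.Topology.FourManifolds.Foliation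

namespace Literature.Topology.PlanarFoliations

variable {X : Type*} [TopologicalSpace X] {F : Foliation ℝ X} {ι : X → ℂ} {v : ℂ} {n : ℕ}

namespace ProngStar

variable (P : ProngStar F ι v n)

/-! ## The inverse of the embedding and the horizontal paths -/

section Horiz

variable [Nonempty X] (hι : IsOpenEmbedding ι)

/-- The inverse of the embedding `ι` (values on its range). [folklore] -/
def lift : ℂ → X := (hι.toOpenPartialHomeomorph ι).symm

omit P in
/-- `lift` inverts `ι` on the range. [folklore] -/
theorem ι_lift {z : ℂ} (hz : z ∈ range ι) : ι (lift hι z) = z := hι.toOpenPartialHomeomorph_right_inv ι hz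

omit P in
/-- `lift` inverts `ι`. [folklore] -/
@[simp] theorem lift_ι (x : X) : lift hι (ι x) = x := hι.toOpenPartialHomeomorph_left_inv ι

omit P in
/-- `lift` is continuous on the range. [folklore] -/
theorem continuousOn_lift : ContinuousOn (lift hι) (range ι) := by
  have := (hι.toOpenPartialHomeomorph ι).continuousOn_symm
  rwa [IsOpenEmbedding.toOpenPartialHomeomorph_target] at this

/-- **The horizontal path** of the sector `j` at the height `h`: `β ↦` the point of `X` over
`pt j (β, h)`. [folklore] -/
def horiz (j : ZMod n) (h β : ℝ) : X := lift hι (P.pt j (β, h))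

/-- The image of the horizontal path. [folklore] -/
theorem ι_horiz {j : ZMod n} {h β : ℝ} (hr : (β, h) ∈ P.rect) (h0 : ((β, h) : ℝ × ℝ) ≠ 0) :
    ι (P.horiz hι j h β) = P.pt j (β, h) :=
  ι_lift hι (P.diff_subset_range j ⟨P.pt_mem hr, P.pt_ne hr h0⟩)

/-- The horizontal path runs in the sector. [folklore] -/
theorem ι_horiz_mem {j : ZMod n} {h β : ℝ} (hr : (β, h) ∈ P.rect) (h0 : ((β, h) : ℝ × ℝ) ≠ 0) :
    ι (P.horiz hι j h β) ∈ P.S j := by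
  rw [P.ι_horiz hι hr h0]; exact P.pt_mem hr

/-- The height along the horizontal path. [folklore] -/
theorem H_horiz {j : ZMod n} {h β : ℝ} (hr : (β, h) ∈ P.rect) (h0 : ((β, h) : ℝ × ℝ) ≠ 0) :
    P.H (ι (P.horiz hι j h β)) = h := by
  rw [P.ι_horiz hι hr h0, P.H_pt hr]

/-- The sector coordinate along the horizontal path. [folklore] -/
theorem b_horiz {j : ZMod n} {h β : ℝ} (hr : (β, h) ∈ P.rect) (h0 : ((β, h) : ℝ × ℝ) ≠ 0) :
    P.b j (ι (P.horiz hι j h β)) = β := by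
  rw [P.ι_horiz hι hr h0, P.b_pt hr]

/-- The horizontal path through a given point of the sector passes through it. [folklore] -/
theorem horiz_b_eq {j : ZMod n} {x : X} (hx : ι x ∈ P.S j) : P.horiz hι j (P.H (ι x)) (P.b j (ι x)) = x := by
  unfold horiz
  rw [show (P.b j (ι x), P.H (ι x)) = P.chart j (ι x) from rfl, P.pt_chart hx, lift_ι]

/-- **The horizontal path is continuous** on every parameter set over which it stays in the half
square and off `(0, 0)`. [folklore] -/
theorem continuousOn_horiz {j : ZMod n} {h : ℝ} {T : Set ℝ}
    (hT : ∀ β ∈ T, (β, h) ∈ P.rect ∧ ((β, h) : ℝ × ℝ) ≠ 0) : ContinuousOn (P.horiz hι j h) T := by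
  have hc : ContinuousOn (fun β : ℝ ↦ P.pt j (β, h)) T :=
    (P.continuousOn_pt j).comp (continuous_id.prodMk continuous_const).continuousOn fun β hβ ↦ (hT β hβ).1
  exact (continuousOn_lift hι).comp hc fun β hβ ↦ P.diff_subset_range j ⟨P.pt_mem (hT β hβ).1, P.pt_ne (hT β hβ).1 (hT β hβ).2⟩

/-- **The horizontal path is leafwise**: its points over `β₁ ≤ β₂` lie on one leaf. [folklore] -/
theorem horiz_mem_leaf {j : ZMod n} {β₁ β₂ h : ℝ} (hβ : β₁ ≤ β₂) (h₁ : (β₁, h) ∈ P.rect) (h₂ : (β₂, h) ∈ P.rect)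
    (hoff : h ≠ 0 ∨ 0 < β₁) : P.horiz hι j h β₂ ∈ F.leaf (P.horiz hι j h β₁) := by
  have hne₁ : ((β₁, h) : ℝ × ℝ) ≠ 0 := fun h0 ↦ by
    simp only [Prod.ext_iff, Prod.fst_zero, Prod.snd_zero] at h0
    rcases hoff with hh | hb <;> [exact hh h0.2; linarith]
  have hne₂ : ((β₂, h) : ℝ × ℝ) ≠ 0 := fun h0 ↦ by
    simp only [Prod.ext_iff, Prod.fst_zero, Prod.snd_zero] at h0
    rcases hoff with hh | hb <;> [exact hh h0.2; linarith]
  exact P.mem_leaf_of_horizontal hι hβ h₁ h₂ hoff (P.ι_horiz hι h₁ hne₁) (P.ι_horiz hι h₂ hne₂)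

/-- Points of the horizontal path lie on one leaf (no order on the parameters). [folklore] -/
theorem horiz_mem_leaf' {j : ZMod n} {β₁ β₂ h : ℝ} (h₁ : (β₁, h) ∈ P.rect) (h₂ : (β₂, h) ∈ P.rect)
    (hoff : h ≠ 0 ∨ (0 < β₁ ∧ 0 < β₂)) : P.horiz hι j h β₂ ∈ F.leaf (P.horiz hι j h β₁) := by
  rcases le_total β₁ β₂ with hle | hle
  · exact P.horiz_mem_leaf hι hle h₁ h₂ (hoff.imp id And.left)
  · rw [mem_leaf_comm]
    exact P.horiz_mem_leaf hι hle h₂ h₁ (hoff.imp id And.right)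

omit [Nonempty X] in
/-- **The foliated structure, unpacked**: near a point `x` of the sector `j` there is a flow box
`e ∋ x` of the atlas in which the points of the sector at the height of `x` have the height of
`x`. [folklore] -/
theorem exists_eventually_height_eq {j : ZMod n} {x : X} (hx : ι x ∈ P.S j) :
    ∃ e ∈ F.atlas, x ∈ e.source ∧ ∀ᶠ y in 𝓝 x, ι y ∈ P.S j → P.H (ι y) = P.H (ι x) → (e y).2 = (e x).2 := by
  obtain ⟨e, he, hxe, U, hU, hmono⟩ := P.foliated j x hx
  refine ⟨e, he, hxe, ?_⟩
  filter_upwards [hU] with y hyU hyS hH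
  have hxU : x ∈ U := mem_of_mem_nhds hU
  have h₁ := hmono y hyU hyS x hxU hx
  have h₂ := hmono x hxU hx y hyU hyS
  rcases lt_trichotomy ((e y).2) ((e x).2) with h | h | h
  · exact absurd (h₁.1 h) (by rw [hH]; exact lt_irrefl _)
  · exact h
  · exact absurd (h₂.1 h) (by rw [hH]; exact lt_irrefl _)

/-- **The horizontal path is continuous into the leaf space.** [folklore] -/
theorem continuousOn_toLeafSpace_horiz {j : ZMod n} {h : ℝ} {T : Set ℝ}
    (hT : ∀ β ∈ T, (β, h) ∈ P.rect ∧ ((β, h) : ℝ × ℝ) ≠ 0) :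
    ContinuousOn (toLeafSpace ∘ P.horiz hι j h : ℝ → F.LeafSpace) T := by
  rw [continuousOn_iff_continuous_restrict]
  have hg : Continuous (T.restrict (P.horiz hι j h)) :=
    continuousOn_iff_continuous_restrict.1 (P.continuousOn_horiz hι hT)
  refine F.continuous_toLeafSpace_comp_of_exists hg fun a ↦ ?_
  have haS : ι (T.restrict (P.horiz hι j h) a) ∈ P.S j := P.ι_horiz_mem hι (hT a a.2).1 (hT a a.2).2
  obtain ⟨e, he, hae, hev⟩ := P.exists_eventually_height_eq haS
  refine ⟨e, he, hae, ?_⟩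
  filter_upwards [hg.continuousAt.eventually hev] with b hb
  exact hb (P.ι_horiz_mem hι (hT b b.2).1 (hT b b.2).2) (by
    show P.H (ι (P.horiz hι j h b)) = P.H (ι (P.horiz hι j h a))
    rw [P.H_horiz hι (hT b b.2).1 (hT b b.2).2, P.H_horiz hι (hT a a.2).1 (hT a a.2).2])

/-! ### Across the axis: the neighbouring sector of a height -/

/-- **The neighbour of the sector `j` at the height `h`**: the sector sharing with `S j` the half
axis on which the points of height `h` lie (`j + 1` if `0 ≤ sg j * h`, else `j - 1`).
[folklore] -/
def nb (j : ZMod n) (h : ℝ) : ZMod n := if 0 ≤ P.sg j * h then j + 1 else j - 1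

omit [Nonempty X] in
/-- The neighbour is `j - 1` or `j + 1`. [folklore] -/
theorem nb_eq_or (j : ZMod n) (h : ℝ) : P.nb j h = j - 1 ∨ P.nb j h = j + 1 := by
  unfold nb; split_ifs <;> simp

omit [Nonempty X] in
/-- **The axis point of height `h` of the sector `j` lies on the axis of the neighbour.**
[folklore] -/
theorem pt_axis_mem_nb {j : ZMod n} {h : ℝ} (hh : h ∈ Icc (-P.ρ) P.ρ) :
    P.pt j (0, h) ∈ P.S (P.nb j h) ∧ P.b (P.nb j h) (P.pt j (0, h)) = 0 := by
  have hr : ((0, h) : ℝ × ℝ) ∈ P.rect := ⟨⟨le_rfl, P.ρ_pos.le⟩, hh⟩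
  have hS : P.pt j (0, h) ∈ P.S j := P.pt_mem hr
  have hb : P.b j (P.pt j (0, h)) = 0 := P.b_pt hr
  have hH : P.H (P.pt j (0, h)) = h := P.H_pt hr
  unfold nb
  split_ifs with hs
  · have hs' : 0 ≤ P.sg j * P.H (P.pt j (0, h)) := by rwa [hH]
    have hmem := P.mem_succ_of_b_eq_zero hS hb hs'
    exact ⟨hmem, (P.b_eq_zero_of_mem_inter ⟨hS, hmem⟩).2.1⟩
  · have hs' : P.sg j * P.H (P.pt j (0, h)) < 0 := by rw [hH]; exact lt_of_not_ge hs
    exact P.mem_pred_of_b_eq_zero hS hb hs'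

omit [Nonempty X] in
/-- The axis points of height `h` of the sector and of its neighbour coincide. [folklore] -/
theorem pt_nb_zero {j : ZMod n} {h : ℝ} (hh : h ∈ Icc (-P.ρ) P.ρ) : P.pt (P.nb j h) (0, h) = P.pt j (0, h) := by
  obtain ⟨hS, hb⟩ := P.pt_axis_mem_nb hh
  have hr : ((0, h) : ℝ × ℝ) ∈ P.rect := ⟨⟨le_rfl, P.ρ_pos.le⟩, hh⟩
  have hchart : P.chart (P.nb j h) (P.pt j (0, h)) = (0, h) := by
    rw [P.chart_apply, hb, P.H_pt hr]
  conv_lhs => rw [← hchart]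
  rw [P.pt_chart hS]

/-- The horizontal paths of the sector and of its neighbour agree at the axis. [folklore] -/
theorem horiz_nb_zero {j : ZMod n} {h : ℝ} (hh : h ∈ Icc (-P.ρ) P.ρ) : P.horiz hι (P.nb j h) h 0 = P.horiz hι j h 0 := by
  unfold horiz; rw [P.pt_nb_zero hh]

/-- **Leaves cross the axis into the neighbouring sector**: the leaf through a point of the
sector `j` at a height `h ≠ 0` contains the whole horizontal of height `h` of the neighbour
`nb j h` (the hyperbolic sector between the prong of `j` and the prong of `nb j h`).
[cite: CamachoLinsNeto1985, Ch. VII §2] -/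
theorem horiz_nb_mem_leaf {j : ZMod n} {x : X} (hx : ι x ∈ P.S j) (hH : P.H (ι x) ≠ 0) {β : ℝ} (hβ : β ∈ Icc 0 P.ρ) :
    P.horiz hι (P.nb j (P.H (ι x))) (P.H (ι x)) β ∈ F.leaf x := by
  obtain ⟨h, hh⟩ : ∃ h, h = P.H (ι x) := ⟨_, rfl⟩
  rw [← hh]
  have hrect := P.chart_mem_rect hx
  rw [P.chart_apply, P.mem_rect_iff, ← hh] at hrect
  obtain ⟨hbI, hhI⟩ := hrect
  have hH' : h ≠ 0 := by rw [hh]; exact hH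
  have hr : ∀ β' ∈ Icc 0 P.ρ, ((β', h) : ℝ × ℝ) ∈ P.rect := fun β' hb' ↦ ⟨hb', hhI⟩
  -- from `x` to the axis point in the sector `j`
  have h₁ : P.horiz hι j h 0 ∈ F.leaf x := by
    have := P.horiz_mem_leaf' hι (j := j) (hr _ hbI) (hr 0 ⟨le_rfl, P.ρ_pos.le⟩) (Or.inl hH')
    rw [hh, P.horiz_b_eq hι hx] at this
    rwa [hh]
  -- from the axis point along the neighbour's horizontal
  have h₂ : P.horiz hι (P.nb j h) h β ∈ F.leaf (P.horiz hι (P.nb j h) h 0) :=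
    P.horiz_mem_leaf hι hβ.1 (hr 0 ⟨le_rfl, P.ρ_pos.le⟩) (hr β hβ) (Or.inl hH')
  rw [P.horiz_nb_zero hι hhI, leaf_eq_of_mem h₁] at h₂
  exact h₂

end Horiz

/-! ## The horizontal path as a path of a leaf -/

section LeafPath

variable (hι : IsOpenEmbedding ι) {x : X}

/-- A point of `X` on the leaf of `x`, as a point of `F.Leaf x`. [folklore] -/
def leafPt (y : X) (hy : y ∈ F.leaf x) : F.Leaf x := Leaf.mk y hy

omit P hι in
/-- The underlying point of `leafPt`. [folklore] -/
@[simp] theorem pt_leafPt (y : X) (hy : y ∈ F.leaf x) : Leaf.pt (leafPt y hy) = y := rfl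

omit P hι in
/-- **A leafwise continuous map into the leaf of `x` is continuous into `F.Leaf x`**, on a set.
[folklore] -/
theorem continuousOn_leafPt {g : ℝ → X} {T : Set ℝ} (hg : ContinuousOn (toLeafSpace ∘ g : ℝ → F.LeafSpace) T)
    (hmem : ∀ β ∈ T, g β ∈ F.leaf x) {f : ℝ → F.Leaf x} (hf : ∀ β (hβ : β ∈ T), f β = leafPt (g β) (hmem β hβ)) :
    ContinuousOn f T := by
  rw [continuousOn_iff_continuous_restrict] at hg ⊢
  have hval : Continuous (fun b : T ↦ ((T.restrict f b : F.Leaf x) : F.LeafSpace)) := by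
    have : (fun b : T ↦ ((T.restrict f b : F.Leaf x) : F.LeafSpace)) = T.restrict (toLeafSpace ∘ g) := by
      funext b
      show ((f b : F.Leaf x) : F.LeafSpace) = toLeafSpace (g b)
      rw [hf b b.2]; rfl
    rw [this]; exact hg
  exact continuous_induced_rng.2 hval

end LeafPath

/-! ## Forward ends near `v` have height `0` -/

section Fwd

variable [T2Space X] [SecondCountableTopology X] (hι : IsOpenEmbedding ι) {x : X} [NoncompactSpace (F.Leaf x)]
  {hbi : IsBiOriented F}
include hι

/-- **The order-convexity step.** Let `z = ι (Leaf.pt q)` lie in the sector `j` at a height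
`h ≠ 0`. Then some point of the forward half-leaf of `q` lies in a sector `j'` with sector
coordinate `ρ` (an outer point of the star). [folklore] -/
theorem exists_mem_fwd_outer [NeZero n] {q : F.Leaf x} {j : ZMod n} (hq : ι (Leaf.pt q) ∈ P.S j)
    (hH : P.H (ι (Leaf.pt q)) ≠ 0) :
    ∃ q' ∈ fwd hbi q, ∃ j', ι (Leaf.pt q') ∈ P.S j' ∧ P.b j' (ι (Leaf.pt q')) = P.ρ := by
  haveI : Nonempty X := ⟨x⟩
  -- notation (plain abbreviations, unfolded by `rfl`)
  obtain ⟨h, hh⟩ : ∃ h, h = P.H (ι (Leaf.pt q)) := ⟨_, rfl⟩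
  obtain ⟨βz, hβz⟩ : ∃ βz, βz = P.b j (ι (Leaf.pt q)) := ⟨_, rfl⟩
  have hrect := P.chart_mem_rect hq
  rw [P.chart_apply, P.mem_rect_iff, ← hh, ← hβz] at hrect
  obtain ⟨⟨hβ0, hβρ⟩, hhI⟩ := hrect
  have hρ := P.ρ_pos
  have hH' : h ≠ 0 := by rw [hh]; exact hH
  -- rect facts along the two horizontals
  have hrect_j : ∀ β ∈ Icc 0 P.ρ, ((β, h) : ℝ × ℝ) ∈ P.rect ∧ ((β, h) : ℝ × ℝ) ≠ 0 := fun β hb ↦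
    ⟨⟨hb, hhI⟩, fun h0 ↦ hH' (congrArg Prod.snd h0)⟩
  -- the axis point and the neighbouring sector
  set a : X := P.horiz hι j h 0 with ha
  have haS : ι a ∈ P.S j := P.ι_horiz_mem hι (hrect_j 0 ⟨le_rfl, hρ.le⟩).1 (hrect_j 0 ⟨le_rfl, hρ.le⟩).2
  have hab : P.b j (ι a) = 0 := P.b_horiz hι (hrect_j 0 ⟨le_rfl, hρ.le⟩).1 (hrect_j 0 ⟨le_rfl, hρ.le⟩).2
  have haH : P.H (ι a) = h := P.H_horiz hι (hrect_j 0 ⟨le_rfl, hρ.le⟩).1 (hrect_j 0 ⟨le_rfl, hρ.le⟩).2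
  obtain ⟨j', hj'S, hj'b⟩ : ∃ j', ι a ∈ P.S j' ∧ P.b j' (ι a) = 0 ∧ (j' = j - 1 ∨ j' = j + 1) := by
    by_cases hs : 0 ≤ P.sg j * P.H (ι a)
    · refine ⟨j + 1, P.mem_succ_of_b_eq_zero haS hab hs, ?_, Or.inr rfl⟩
      exact (P.b_eq_zero_of_mem_inter ⟨haS, P.mem_succ_of_b_eq_zero haS hab hs⟩).2.1
    · obtain ⟨h₁, h₂⟩ := P.mem_pred_of_b_eq_zero haS hab (lt_of_not_ge hs)
      exact ⟨j - 1, h₁, h₂, Or.inl rfl⟩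
  -- all the points of the two horizontals are on the leaf of `q`
  have hz_eq : P.horiz hι j h βz = Leaf.pt q := by rw [hh, hβz]; exact P.horiz_b_eq hι hq
  have hqx : Leaf.pt q ∈ F.leaf x := q.2
  have hmem_j : ∀ β ∈ Icc 0 P.ρ, P.horiz hι j h β ∈ F.leaf x := fun β hb ↦ by
    have h₁ : P.horiz hι j h β ∈ F.leaf (P.horiz hι j h βz) :=
      P.horiz_mem_leaf' hι (hrect_j βz ⟨hβ0, hβρ⟩).1 (hrect_j β hb).1 (Or.inl hH')
    rwa [hz_eq, leaf_eq_of_mem hqx] at h₁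
  have ha' : P.horiz hι j' h 0 = a := by
    have := P.horiz_b_eq hι hj'S
    rwa [haH, hj'b.1] at this
  have ha_mem : a ∈ F.leaf x := hmem_j 0 ⟨le_rfl, hρ.le⟩
  have hmem_j' : ∀ β ∈ Icc 0 P.ρ, P.horiz hι j' h β ∈ F.leaf x := fun β hb ↦ by
    have h₁ : P.horiz hι j' h β ∈ F.leaf (P.horiz hι j' h 0) :=
      P.horiz_mem_leaf hι hb.1 (hrect_j 0 ⟨le_rfl, hρ.le⟩).1 (hrect_j β hb).1 (Or.inl hH')
    rwa [ha', leaf_eq_of_mem ha_mem] at h₁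
  -- the two horizontals as maps into the leaf
  set f : ℝ → F.Leaf x := fun β ↦ if hb : β ∈ Icc 0 P.ρ then leafPt (P.horiz hι j h β) (hmem_j β hb) else q with hf
  set f' : ℝ → F.Leaf x := fun β ↦ if hb : β ∈ Icc 0 P.ρ then leafPt (P.horiz hι j' h β) (hmem_j' β hb) else q with hf'
  have hf_eq : ∀ β (hb : β ∈ Icc 0 P.ρ), f β = leafPt (P.horiz hι j h β) (hmem_j β hb) := fun β hb ↦ by
    simp only [hf, dif_pos hb]
  have hf'_eq : ∀ β (hb : β ∈ Icc 0 P.ρ), f' β = leafPt (P.horiz hι j' h β) (hmem_j' β hb) := fun β hb ↦ by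
    simp only [hf', dif_pos hb]
  have hfc : ContinuousOn f (Icc 0 P.ρ) :=
    continuousOn_leafPt (P.continuousOn_toLeafSpace_horiz hι hrect_j) hmem_j hf_eq
  have hf'c : ContinuousOn f' (Icc 0 P.ρ) :=
    continuousOn_leafPt (P.continuousOn_toLeafSpace_horiz hι hrect_j) hmem_j' hf'_eq
  have hpt_f : ∀ β ∈ Icc 0 P.ρ, Leaf.pt (f β) = P.horiz hι j h β := fun β hb ↦ by rw [hf_eq β hb]; rfl
  have hpt_f' : ∀ β ∈ Icc 0 P.ρ, Leaf.pt (f' β) = P.horiz hι j' h β := fun β hb ↦ by rw [hf'_eq β hb]; rfl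
  have hfq : f βz = q := by
    apply Leaf.injective_coe F x
    show Leaf.pt (f βz) = Leaf.pt q
    rw [hpt_f βz ⟨hβ0, hβρ⟩, hz_eq]
  have hf0 : f' 0 = f 0 := by
    apply Leaf.injective_coe F x
    show Leaf.pt (f' 0) = Leaf.pt (f 0)
    rw [hpt_f 0 ⟨le_rfl, hρ.le⟩, hpt_f' 0 ⟨le_rfl, hρ.le⟩, ha']
  -- the outer points
  set oplus := f P.ρ with hop
  set ominus := f' P.ρ with hom
  -- the two arcs: `A⁺ = f [βz, ρ]`, `A⁻ = f [0, βz] ∪ f' [0, ρ]`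
  set Ap : Set (F.Leaf x) := f '' Icc βz P.ρ with hAp
  set Am : Set (F.Leaf x) := f '' Icc 0 βz ∪ f' '' Icc 0 P.ρ with hAm
  have hApc : IsPreconnected Ap := isPreconnected_Icc.image f (hfc.mono (Icc_subset_Icc hβ0 le_rfl))
  have hAmc : IsPreconnected Am := by
    apply IsPreconnected.union (f 0)
    · exact ⟨0, ⟨le_rfl, hβ0⟩, rfl⟩
    · exact ⟨0, ⟨le_rfl, hρ.le⟩, hf0⟩
    · exact isPreconnected_Icc.image f (hfc.mono (Icc_subset_Icc le_rfl hβρ))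
    · exact isPreconnected_Icc.image f' hf'c
  have hqAp : q ∈ Ap := ⟨βz, ⟨le_rfl, hβρ⟩, hfq⟩
  have hqAm : q ∈ Am := Or.inl ⟨βz, ⟨hβ0, le_rfl⟩, hfq⟩
  have hopAp : oplus ∈ Ap := ⟨P.ρ, ⟨hβρ, le_rfl⟩, rfl⟩
  have homAm : ominus ∈ Am := Or.inr ⟨P.ρ, ⟨hρ.le, le_rfl⟩, rfl⟩
  -- sector coordinates along the arcs
  have hb_Ap : ∀ r ∈ Ap, ι (Leaf.pt r) ∈ P.S j ∧ βz ≤ P.b j (ι (Leaf.pt r)) := by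
    rintro r ⟨β, hb, rfl⟩
    have hb' : β ∈ Icc 0 P.ρ := ⟨hβ0.trans hb.1, hb.2⟩
    rw [hpt_f β hb']
    exact ⟨P.ι_horiz_mem hι (hrect_j β hb').1 (hrect_j β hb').2, by rw [P.b_horiz hι (hrect_j β hb').1 (hrect_j β hb').2]; exact hb.1⟩
  have hb_Am : ∀ r ∈ Am, (ι (Leaf.pt r) ∈ P.S j ∧ P.b j (ι (Leaf.pt r)) ≤ βz) ∨
      (ι (Leaf.pt r) ∈ P.S j' ∧ P.H (ι (Leaf.pt r)) = h) := by
    rintro r (⟨β, hb, rfl⟩ | ⟨β, hb, rfl⟩)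
    · have hb' : β ∈ Icc 0 P.ρ := ⟨hb.1, hb.2.trans hβρ⟩
      rw [hpt_f β hb']
      exact Or.inl ⟨P.ι_horiz_mem hι (hrect_j β hb').1 (hrect_j β hb').2,
        by rw [P.b_horiz hι (hrect_j β hb').1 (hrect_j β hb').2]; exact hb.2⟩
    · rw [hpt_f' β hb]
      exact Or.inr ⟨P.ι_horiz_mem hι (hrect_j β hb).1 (hrect_j β hb).2, P.H_horiz hι (hrect_j β hb).1 (hrect_j β hb).2⟩
  -- a point in both arcs is `q`... more precisely has `b j = βz` or lies on the axis of `j`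
  have key_inter : ∀ r ∈ Ap, r ∈ Am → P.b j (ι (Leaf.pt r)) = βz := by
    intro r hrp hrm
    obtain ⟨hrS, hrb⟩ := hb_Ap r hrp
    rcases hb_Am r hrm with ⟨-, hle⟩ | ⟨hrS', -⟩
    · exact le_antisymm hle hrb
    · -- in both sectors: on the axis of `j`
      have hzero : P.b j (ι (Leaf.pt r)) = 0 := by
        rcases hj'b.2 with rfl | rfl
        · have h' : ι (Leaf.pt r) ∈ P.S (j - 1) ∩ P.S (j - 1 + 1) := by rw [sub_add_cancel]; exact ⟨hrS', hrS⟩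
          have := P.b_eq_zero_of_mem_inter h'
          rw [sub_add_cancel] at this
          exact this.2.1
        · exact (P.b_eq_zero_of_mem_inter ⟨hrS, hrS'⟩).1
      linarith
  -- the outer points have `b = ρ`
  have hop_b : ι (Leaf.pt oplus) ∈ P.S j ∧ P.b j (ι (Leaf.pt oplus)) = P.ρ := by
    rw [hop, hpt_f P.ρ ⟨hρ.le, le_rfl⟩]
    exact ⟨P.ι_horiz_mem hι (hrect_j _ ⟨hρ.le, le_rfl⟩).1 (hrect_j _ ⟨hρ.le, le_rfl⟩).2,
      P.b_horiz hι (hrect_j _ ⟨hρ.le, le_rfl⟩).1 (hrect_j _ ⟨hρ.le, le_rfl⟩).2⟩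
  have hom_b : ι (Leaf.pt ominus) ∈ P.S j' ∧ P.b j' (ι (Leaf.pt ominus)) = P.ρ := by
    rw [hom, hpt_f' P.ρ ⟨hρ.le, le_rfl⟩]
    exact ⟨P.ι_horiz_mem hι (hrect_j _ ⟨hρ.le, le_rfl⟩).1 (hrect_j _ ⟨hρ.le, le_rfl⟩).2,
      P.b_horiz hι (hrect_j _ ⟨hρ.le, le_rfl⟩).1 (hrect_j _ ⟨hρ.le, le_rfl⟩).2⟩
  -- if `βz = ρ`, `q` itself is an outer point
  by_cases hβzρ : βz = P.ρ
  · exact ⟨q, mem_fwd_self q, j, hq, by rw [hβz] at hβzρ; exact hβzρ⟩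
  have hβzlt : βz < P.ρ := lt_of_le_of_ne hβρ hβzρ
  -- `oplus ∉ Am` and `ominus ∉ Ap`
  have hop_nAm : oplus ∉ Am := fun h' ↦ by
    have := key_inter oplus hopAp h'
    rw [hop_b.2] at this
    exact hβzρ this.symm
  have hom_nAp : ominus ∉ Ap := fun h' ↦ by
    have h₁ := key_inter ominus h' homAm
    obtain ⟨hS, -⟩ := hb_Ap ominus h'
    -- `ominus` is in `S j ∩ S j'` hence on the axis of `j'`, but `b j' = ρ`
    have hzero : P.b j' (ι (Leaf.pt ominus)) = 0 := by
      rcases hj'b.2 with rfl | rfl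
      · have h'' : ι (Leaf.pt ominus) ∈ P.S (j - 1) ∩ P.S (j - 1 + 1) := by
          rw [sub_add_cancel]; exact ⟨hom_b.1, hS⟩
        exact (P.b_eq_zero_of_mem_inter h'').1
      · exact (P.b_eq_zero_of_mem_inter ⟨hS, hom_b.1⟩).2.1
    rw [hom_b.2] at hzero
    exact absurd hzero hρ.ne'
  -- order: not both outer points before `q`
  have hconv : ¬ (leafLT hbi oplus q ∧ leafLT hbi ominus q) := by
    rintro ⟨h₁, h₂⟩
    rcases leafLT_trichotomy (hbi := hbi) ominus oplus with hlt | heq | hlt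
    · -- `ominus < oplus < q`: `oplus ∈ [ominus, q] ⊆ Am`
      have hsub := leafIcc_subset_of_isPreconnected (hbi := hbi) hAmc homAm hqAm
      exact hop_nAm (hsub ⟨leafLT_asymm hlt, leafLT_asymm h₁⟩)
    · exact hop_nAm (heq ▸ homAm)
    · -- `oplus < ominus < q`: `ominus ∈ [oplus, q] ⊆ Ap`
      have hsub := leafIcc_subset_of_isPreconnected (hbi := hbi) hApc hopAp hqAp
      exact hom_nAp (hsub ⟨leafLT_asymm hlt, leafLT_asymm h₂⟩)
  rcases not_and_or.1 hconv with h₁ | h₂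
  · exact ⟨oplus, h₁, j, hop_b⟩
  · exact ⟨ominus, h₂, j', hom_b⟩

/-- **Once a forward half-leaf stays within distance `c` of `v` (with `c` as in
`exists_le_dist`), its points in the star have height `0`.** [folklore] -/
theorem H_eq_zero_of_fwd [NeZero n] {c : ℝ} (hc : ∀ j, ∀ z ∈ P.S j, P.ρ / 2 ≤ P.b j z → c ≤ dist z v)
    {p : F.Leaf x} (hp : ∀ q ∈ fwd hbi p, dist (ι (Leaf.pt q)) v < c) {q : F.Leaf x} (hq : q ∈ fwd hbi p)
    {j : ZMod n} (hqS : ι (Leaf.pt q) ∈ P.S j) : P.H (ι (Leaf.pt q)) = 0 := by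
  by_contra hH
  obtain ⟨q', hq', j', hS', hb'⟩ := P.exists_mem_fwd_outer hι (hbi := hbi) hqS hH
  have h₁ := hc j' _ hS' (by rw [hb']; linarith [P.ρ_pos])
  have h₂ := hp q' (fwd_mono hq hq')
  linarith

/-- **A forward leaf end converging to `v` is a prong end.** If the leaf of `x` lies in a
compact set `C` and its ω-limit set is contained in `{v}`, then for some sector `j`, some point
`p` of the leaf over the prong of `j` and its parameter `β₀ ∈ (0, ρ]`, the forward half-leaf of
`p` consists exactly of the points over `{(β, 0) | 0 < β ≤ β₀}` of the sector `j`.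
[cite: CamachoLinsNeto1985, Ch. VII §2] -/
theorem exists_fwd_eq_prong [NeZero n] {C : Set ℂ} (hC : IsCompact C) (hmem : ∀ q : F.Leaf x, ι (Leaf.pt q) ∈ C)
    (hω : omegaSet hbi ι x ⊆ {v}) :
    ∃ (j : ZMod n) (p : F.Leaf x) (β₀ : ℝ), β₀ ∈ Ioc 0 P.ρ ∧ ι (Leaf.pt p) = P.pt j (β₀, 0) ∧
      ∀ q : F.Leaf x, q ∈ fwd hbi p ↔ ∃ β ∈ Ioc 0 β₀, ι (Leaf.pt q) = P.pt j (β, 0) := by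
  haveI : Nonempty X := ⟨x⟩
  have hρ := P.ρ_pos
  -- constants
  obtain ⟨c, hc, hcdist⟩ := P.exists_le_dist inferInstance
  obtain ⟨ε₀, hε₀, hball₀⟩ := Metric.mem_nhds_iff.1 P.iUnion_mem_nhds
  set ε := min ε₀ c with hε
  have hεpos : 0 < ε := lt_min hε₀ hc
  -- the forward half-leaf eventually within `ε` of `v`
  obtain ⟨p, hp⟩ := PunctureData.exists_image_fwd_subset (hbi := hbi) hC hmem isOpen_ball
    (fun w hw ↦ by rw [hω hw]; exact mem_ball_self hεpos)
  have hp' : ∀ q ∈ fwd hbi p, dist (ι (Leaf.pt q)) v < ε := fun q hq ↦ hp ⟨q, hq, rfl⟩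
  have hpc : ∀ q ∈ fwd hbi p, dist (ι (Leaf.pt q)) v < c := fun q hq ↦ (hp' q hq).trans_le (min_le_right _ _)
  -- every point of the forward half-leaf is on a prong, with parameter `< ρ / 2`
  have hprong : ∀ q ∈ fwd hbi p, ∃ j, ι (Leaf.pt q) ∈ P.S j ∧ P.H (ι (Leaf.pt q)) = 0 ∧
      0 < P.b j (ι (Leaf.pt q)) ∧ P.b j (ι (Leaf.pt q)) < P.ρ / 2 := by
    intro q hq
    have hmemU : ι (Leaf.pt q) ∈ ⋃ j, P.S j := hball₀ ((hp' q hq).trans_le (min_le_left _ _))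
    obtain ⟨j, hj⟩ := mem_iUnion.1 hmemU
    have hH : P.H (ι (Leaf.pt q)) = 0 := P.H_eq_zero_of_fwd hι (hbi := hbi) hcdist hpc hq hj
    have hblt : P.b j (ι (Leaf.pt q)) < P.ρ / 2 := by
      by_contra hge
      have := hcdist j _ hj (le_of_not_gt hge)
      linarith [hpc q hq]
    have hbpos : 0 < P.b j (ι (Leaf.pt q)) := by
      have h0 : 0 ≤ P.b j (ι (Leaf.pt q)) := (P.chart_mem_rect hj).1.1
      rcases h0.eq_or_lt with h | h
      · exfalso
        apply P.ne_v (Leaf.pt q)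
        have : P.chart j (ι (Leaf.pt q)) = 0 := by
          rw [P.chart_apply, ← h, hH]; rfl
        rw [← P.pt_chart hj, this, P.pt_zero]
      · exact h
    exact ⟨j, hj, hH, hbpos, hblt⟩
  -- the sector and the parameter of `p`
  obtain ⟨j, hjS, hjH, hjpos, hjlt⟩ := hprong p (mem_fwd_self p)
  set β₀ := P.b j (ι (Leaf.pt p)) with hβ₀
  have hβ₀I : β₀ ∈ Ioc 0 P.ρ := ⟨hjpos, by linarith⟩
  have hp_eq : ι (Leaf.pt p) = P.pt j (β₀, 0) := by
    rw [show ((β₀, 0) : ℝ × ℝ) = P.chart j (ι (Leaf.pt p)) by rw [P.chart_apply, hjH], P.pt_chart hjS]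
  refine ⟨j, p, β₀, hβ₀I, hp_eq, ?_⟩
  -- rect facts along the prong
  have hrect : ∀ β ∈ Ioc 0 P.ρ, ((β, 0) : ℝ × ℝ) ∈ P.rect ∧ ((β, 0) : ℝ × ℝ) ≠ 0 := fun β hb ↦
    ⟨⟨⟨hb.1.le, hb.2⟩, ⟨by linarith, hρ.le⟩⟩, fun h0 ↦ by
      have := congrArg Prod.fst h0; simp only [Prod.fst_zero] at this; linarith [hb.1]⟩
  -- the prong path, with values in the leaf
  have hp_horiz : P.horiz hι j 0 β₀ = Leaf.pt p := by
    have := P.horiz_b_eq hι hjS; rwa [hjH] at this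
  have hpx : Leaf.pt p ∈ F.leaf x := p.2
  have hmemL : ∀ β ∈ Ioc 0 P.ρ, P.horiz hι j 0 β ∈ F.leaf x := fun β hb ↦ by
    have h₁ : P.horiz hι j 0 β ∈ F.leaf (P.horiz hι j 0 β₀) :=
      P.horiz_mem_leaf' hι (hrect β₀ hβ₀I).1 (hrect β hb).1 (Or.inr ⟨hβ₀I.1, hb.1⟩)
    rwa [hp_horiz, leaf_eq_of_mem hpx] at h₁
  set f : ℝ → F.Leaf x := fun β ↦ if hb : β ∈ Ioc 0 P.ρ then leafPt (P.horiz hι j 0 β) (hmemL β hb) else p with hf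
  have hf_eq : ∀ β (hb : β ∈ Ioc 0 P.ρ), f β = leafPt (P.horiz hι j 0 β) (hmemL β hb) := fun β hb ↦ by
    simp only [hf, dif_pos hb]
  have hfc : ContinuousOn f (Ioc 0 P.ρ) := continuousOn_leafPt (P.continuousOn_toLeafSpace_horiz hι hrect) hmemL hf_eq
  have hpt_f : ∀ β ∈ Ioc 0 P.ρ, Leaf.pt (f β) = P.horiz hι j 0 β := fun β hb ↦ by rw [hf_eq β hb]; rfl
  have hι_f : ∀ β ∈ Ioc 0 P.ρ, ι (Leaf.pt (f β)) = P.pt j (β, 0) := fun β hb ↦ by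
    rw [hpt_f β hb, P.ι_horiz hι (hrect β hb).1 (hrect β hb).2]
  have hf_inj : ∀ β ∈ Ioc 0 P.ρ, ∀ β' ∈ Ioc 0 P.ρ, f β = f β' → β = β' := fun β hb β' hb' h ↦ by
    have h₁ : P.pt j (β, 0) = P.pt j (β', 0) := by rw [← hι_f β hb, ← hι_f β' hb', h]
    have h₂ := congrArg (P.chart j) h₁
    rw [P.chart_pt (hrect β hb).1, P.chart_pt (hrect β' hb').1] at h₂
    exact congrArg Prod.fst h₂
  have hfp : f β₀ = p := by
    apply Leaf.injective_coe F x
    show Leaf.pt (f β₀) = Leaf.pt p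
    rw [hpt_f β₀ hβ₀I, hp_horiz]
  -- images of subintervals are preconnected
  have himg : ∀ a b, 0 < a → b ≤ P.ρ → IsPreconnected (f '' Icc a b) := fun a b ha hb ↦
    isPreconnected_Icc.image f (hfc.mono fun β hβ ↦ ⟨ha.trans_le hβ.1, hβ.2.trans hb⟩)
  -- the outer point is before `p`
  set o := f P.ρ with ho
  have hρI : P.ρ ∈ Ioc 0 P.ρ := ⟨hρ, le_rfl⟩
  have ho_far : c ≤ dist (ι (Leaf.pt o)) v := by
    refine hcdist j _ ?_ ?_
    · rw [hι_f P.ρ hρI]; exact P.pt_mem (hrect P.ρ hρI).1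
    · rw [hι_f P.ρ hρI, P.b_pt (hrect P.ρ hρI).1]; linarith
  have ho_nfwd : o ∉ fwd hbi p := fun h' ↦ by linarith [hpc o h']
  have hop : leafLT hbi o p := by
    rcases leafLT_trichotomy (hbi := hbi) o p with h' | h' | h'
    · exact h'
    · exact absurd (h' ▸ mem_fwd_self p) ho_nfwd
    · exact absurd (mem_fwd_of_leafLT h') ho_nfwd
  -- (i) the points over `(0, β₀]` are in the forward half-leaf
  have hT_fwd : ∀ β ∈ Ioc 0 β₀, f β ∈ fwd hbi p := by
    intro β hb hlt
    have hbI : β ∈ Ioc 0 P.ρ := ⟨hb.1, hb.2.trans hβ₀I.2⟩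
    have hne : β ≠ β₀ := fun h' ↦ by rw [h', hfp] at hlt; exact leafLT_irrefl p hlt
    have hβlt : β < β₀ := lt_of_le_of_ne hb.2 hne
    rcases leafLT_trichotomy (hbi := hbi) o (f β) with h' | h' | h'
    · -- `o < f β < p`: `f β ∈ [o, p] ⊆ f [β₀, ρ]`
      have hsub := leafIcc_subset_of_isPreconnected (hbi := hbi) (himg β₀ P.ρ hβ₀I.1 le_rfl)
        (show o ∈ f '' Icc β₀ P.ρ from ⟨P.ρ, ⟨hβ₀I.2, le_rfl⟩, rfl⟩)
        (show p ∈ f '' Icc β₀ P.ρ from ⟨β₀, ⟨le_rfl, hβ₀I.2⟩, hfp⟩)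
      obtain ⟨β', hb', hββ'⟩ := hsub ⟨leafLT_asymm h', leafLT_asymm hlt⟩
      have := hf_inj β' ⟨hβ₀I.1.trans_le hb'.1, hb'.2⟩ β hbI hββ'
      linarith [hb'.1]
    · have := hf_inj P.ρ hρI β hbI h'
      linarith [hβ₀I.2]
    · -- `f β < o < p`: `o ∈ [f β, p] ⊆ f [β, β₀]`
      have hsub := leafIcc_subset_of_isPreconnected (hbi := hbi) (himg β β₀ hb.1 hβ₀I.2)
        (show f β ∈ f '' Icc β β₀ from ⟨β, ⟨le_rfl, hb.2⟩, rfl⟩)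
        (show p ∈ f '' Icc β β₀ from ⟨β₀, ⟨hb.2, le_rfl⟩, hfp⟩)
      obtain ⟨β', hb', hββ'⟩ := hsub ⟨leafLT_asymm h', leafLT_asymm hop⟩
      have := hf_inj β' ⟨hb.1.trans_le hb'.1, hb'.2.trans hβ₀I.2⟩ P.ρ hρI hββ'
      linarith [hb'.2, hβ₀I.2]
  -- (ii) every point of the forward half-leaf is over `(0, β₀]`
  have hfwd_T : ∀ w ∈ fwd hbi p, ∃ β ∈ Ioc 0 β₀, f β = w := by
    intro w hw
    -- a point of the prong close to `v`, beyond the compact interval `[p, w]`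
    set K := leafIcc hbi p w with hK
    have hKc : IsCompact K := isCompact_leafIcc p w
    set Kι : Set ℂ := (fun r : F.Leaf x ↦ ι (Leaf.pt r)) '' K with hKι
    have hKιc : IsCompact Kι := hKc.image (hι.continuous.comp (Leaf.continuous_coe F x))
    have hvK : v ∉ Kι := by rintro ⟨r, -, hr⟩; exact P.ne_v (Leaf.pt r) hr
    have hKne : Kι.Nonempty := ⟨_, p, left_mem_leafIcc hw, rfl⟩
    have hδ : 0 < infDist v Kι := (hKιc.isClosed.notMem_iff_infDist_pos hKne).1 hvK
    obtain ⟨δ', hδ', hnear⟩ := P.exists_dist_pt_lt j hδ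
    set β₁ := min β₀ (δ' / 2) with hβ₁
    have hβ₁pos : 0 < β₁ := lt_min hβ₀I.1 (by linarith)
    have hβ₁le : β₁ ≤ β₀ := min_le_left _ _
    have hβ₁I : β₁ ∈ Ioc 0 P.ρ := ⟨hβ₁pos, hβ₁le.trans hβ₀I.2⟩
    have hnorm : ‖((β₁, 0) : ℝ × ℝ)‖ < δ' := by
      rw [Prod.norm_mk, Real.norm_of_nonneg hβ₁pos.le, norm_zero, max_eq_left hβ₁pos.le]
      linarith [min_le_right β₀ (δ' / 2)]
    have ht₁close : dist (ι (Leaf.pt (f β₁))) v < infDist v Kι := by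
      rw [hι_f β₁ hβ₁I]; exact hnear _ (hrect β₁ hβ₁I).1 hnorm
    have ht₁K : f β₁ ∉ K := fun h' ↦ by
      have hmemK : ι (Leaf.pt (f β₁)) ∈ Kι := ⟨f β₁, h', rfl⟩
      have := infDist_le_dist_of_mem hmemK (x := v)
      rw [dist_comm] at this
      linarith
    have ht₁fwd : f β₁ ∈ fwd hbi p := hT_fwd β₁ ⟨hβ₁pos, hβ₁le⟩
    have hwt₁ : leafLT hbi w (f β₁) := by
      by_contra h'
      exact ht₁K ⟨ht₁fwd, h'⟩
    -- `w ∈ [p, f β₁] ⊆ f [β₁, β₀]`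
    have hsub := leafIcc_subset_of_isPreconnected (hbi := hbi) (himg β₁ β₀ hβ₁pos hβ₀I.2)
      (show p ∈ f '' Icc β₁ β₀ from ⟨β₀, ⟨hβ₁le, le_rfl⟩, hfp⟩)
      (show f β₁ ∈ f '' Icc β₁ β₀ from ⟨β₁, ⟨le_rfl, hβ₁le⟩, rfl⟩)
    obtain ⟨β, hb, hβw⟩ := hsub ⟨hw, leafLT_asymm hwt₁⟩
    exact ⟨β, ⟨hβ₁pos.trans_le hb.1, hb.2⟩, hβw⟩
  -- conclusion
  intro q
  constructor
  · intro hq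
    obtain ⟨β, hb, rfl⟩ := hfwd_T q hq
    exact ⟨β, hb, hι_f β ⟨hb.1, hb.2.trans hβ₀I.2⟩⟩
  · rintro ⟨β, hb, hq⟩
    have hbI : β ∈ Ioc 0 P.ρ := ⟨hb.1, hb.2.trans hβ₀I.2⟩
    have : q = f β := by
      apply Leaf.injective_coe F x
      apply hι.injective
      show ι (Leaf.pt q) = ι (Leaf.pt (f β))
      rw [hq, hι_f β hbI]
    rw [this]
    exact hT_fwd β hb

end Fwd

/-! ## Backward ends: the flipped star -/

/-- **The same star for the flipped foliation** (reversed leaf directions, same heights).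
[folklore] -/
def flip : ProngStar F.flip ι v n where
  S := P.S
  b := P.b
  H := P.H
  sg := P.sg
  ρ := P.ρ
  ρ_pos := P.ρ_pos
  sg_sq := P.sg_sq
  sg_succ := P.sg_succ
  isCompact := P.isCompact
  mem := P.mem
  iUnion_mem_nhds := P.iUnion_mem_nhds
  H_v := P.H_v
  b_v := P.b_v
  continuousOn_H := P.continuousOn_H
  continuousOn_b := P.continuousOn_b
  injOn := P.injOn
  image_eq := P.image_eq
  inter_succ := P.inter_succ
  inter_succ' := P.inter_succ'
  axis_subset := P.axis_subset
  eq_of_mem_inter := P.eq_of_mem_inter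
  diff_subset_range := P.diff_subset_range
  not_mem_range := P.not_mem_range
  foliated j x hx := by
    obtain ⟨e, he, hxe, U, hU, hmono⟩ := P.foliated j x hx
    exact ⟨flipChart e, flipChart_mem_flip he, hxe, U, hU, fun y hy hyS z hz hzS ↦ by
      simp only [flipChart_apply]; exact hmono y hy hyS z hz hzS⟩

/-- The inverse coordinates of the flipped star. [folklore] -/
@[simp] theorem pt_flip (j : ZMod n) : P.flip.pt j = P.pt j := rfl

section Bwd

variable [T2Space X] [SecondCountableTopology X] (hι : IsOpenEmbedding ι) {x : X} [NoncompactSpace (F.Leaf x)]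
  {hbi : IsBiOriented F}
include hι

/-- **A backward leaf end converging to `v` is a prong end.** [cite: CamachoLinsNeto1985, Ch. VII §2] -/
theorem exists_bwd_eq_prong [NeZero n] {C : Set ℂ} (hC : IsCompact C) (hmem : ∀ q : F.Leaf x, ι (Leaf.pt q) ∈ C)
    (hα : alphaSet hbi ι x ⊆ {v}) :
    ∃ (j : ZMod n) (p : F.Leaf x) (β₀ : ℝ), β₀ ∈ Ioc 0 P.ρ ∧ ι (Leaf.pt p) = P.pt j (β₀, 0) ∧
      ∀ q : F.Leaf x, q ∈ bwd hbi p ↔ ∃ β ∈ Ioc 0 β₀, ι (Leaf.pt q) = P.pt j (β, 0) := by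
  rw [alphaSet_eq_omegaSet_flip] at hα
  obtain ⟨j, p', β₀, hβ₀, hp', hiff⟩ := P.flip.exists_fwd_eq_prong hι (hbi := isBiOriented_flip hbi) hC
    (fun q ↦ hmem ((Leaf.toFlip x).symm q)) hα
  refine ⟨j, (Leaf.toFlip x).symm p', β₀, hβ₀, hp', fun q ↦ ?_⟩
  rw [← toFlip_mem_fwd_iff, (Leaf.toFlip x).apply_symm_apply]
  exact hiff (Leaf.toFlip x q)

end Bwd

end ProngStar

end Literature.Topology.PlanarFoliations
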